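import Summits.CriticalPhenomena.Ising3DConformalLimit.Theses.LeeYangGap
import Summits.CriticalPhenomena.Ising3DConformalLimit.Theses.ArmHyperscaling
import Summits.CriticalPhenomena.Ising3DConformalLimit.Theorems.ArmHyperscalingMergingFloorGlue
import Summits.CriticalPhenomena.Ising3DConformalLimit.Theorems.PerfectScreeningCoulombImpliesNontrivialGapOfBinder
import HarnessLib

/-!
# Line `one-arm-saturation` — crux `NearCriticalLeeYangGap` (stmt-CriticalPhenomena-4945, route LeeYangGap)

Strategist planner-cstrat-stmt-CriticalPhenomena-4945-s1-0 (census family `s`), 2026-08-17.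
Lens: `transfer` at crux level, from the sibling crux stmt-CriticalPhenomena-0636 (`IsingEuclidUpgradeR4NonGaussian`,
line `isotherm-saturation-lee-yang`) and crux 15592 (`MergingFloor`, line `one-arm-isotherm-lattice`), whose two
provable stubs are LANDED (`ArmHyperscalingMergingFloorLeeYangDeficit`, `…OneArmGivesMatchedIsotherm`, glue
`ArmHyperscalingMergingFloorGlue`: PAYER EDGE item 15591 ⟹ item 0636).

**Idea.** `GAP ⟸ OneArmHyperscaling` (item stmt-CriticalPhenomena-15591, route ArmHyperscaling, BY NAME) —
UNCONDITIONALLY, i.e. with NO scaling-limit hypothesis. In the landed proof of 15591 ⟹ 0636 the scaling limit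
(`HasPointwiseScalingLimit`, non-degeneracy, scale covariance) is used at exactly two places, both only to produce
GOOD SCALES *eventually in `L`*: the field-term doubling `χ(⌊ηL⌋) ≤ χ(L/2)/108` (`exists_eta_boxSum_floor_le`) and the
axis ratio `G(2⌊tL⌋e₀) ≤ R·G(2Le₀)` (`eventually_axis_ratio`). The crux `NearCriticalLeeYangGap` only asks for
`∃ᶠ L`. The new lever is the elementary **simultaneous-good-scales lemma** `stub_simultaneousScales`: from the
critical envelopes `c/n² ≤ G(ne₀) ≤ 1`, axis monotonicity and the Messager–Miracle-Solé comparisons alone, BOTH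
conditions hold SIMULTANEOUSLY for infinitely many `L` (a counting argument on dyadic scales: scales violating the
axis ratio with a large `R` are sparse because each costs a factor `R` of decay against the `n⁻²` floor; scales
violating the doubling cost susceptibility growth against `χ_L ≥ cL`). At such `L`, steps 1–4 of the landed
`stub_oneArmGivesMatchedIsotherm` give the MATCHED UPPER CRITICAL ISOTHERM `(2L+1)³·m(β_c, C/√Σ_L) ≤ ½β_c C √Σ_L`
(`stub_matchedIsothermFrequently_of_oneArm`), and the landed Lee–Yang deficit + GKS block-field domination +
`binder_lower_of_saturation` give the block Binder floor `g_L ≥ 1/(2β_c²C²)` at the same `L` (PROVED below,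
`frequently_binder_ge_of_matchedIsotherm`), whence `¬(g_L → 0)` and the crux by the landed
`PerfectScreeningCoulombImpliesNontrivial.stub_gapOfBinderNonvanishing` (PROVED below, `gap_of_matchedIsothermFrequently`).

**Stubs** (3 registered; sorries ONLY in `stub_*`):
* `stub_oneArmHyperscaling` — item stmt-CriticalPhenomena-15591 `ArmHyperscaling.OneArmHyperscaling` BY NAME (OPEN, the
  hardest stub; staffed on route ArmHyperscaling, line `mirror-face-saturation`; MC j024350: the ratio saturates).
* `stub_simultaneousScales` — NEW, unconditional, size M–L (dyadic counting; ingredients all in tree: `axis_sq_level_ge`,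
  `axis_level_le`, axis antitonicity, MMS box/axis comparisons, `SusceptibilityDoubling`).
* `stub_matchedIsothermFrequently_of_oneArm` — size M: the landed `stub_oneArmGivesMatchedIsotherm` with its two
  limit lemmas replaced by the hypothesis `stub_simultaneousScales` and `∀ᶠ` by `∃ᶠ` (steps 1, 2, 4 verbatim:
  `mag_le_boxMag_add`, `card_mul_boxSum_le_blockSum`, `card_sq_mul_axis_le_blockSum`, `matched_arith`).

**Composition** `NearCriticalLeeYangGap_of : OneArmHyperscaling → S2 → S3 → NearCriticalLeeYangGap` is kernel-checked
(no sorry) and concludes the crux BY NAME. Why it dodges the STUCK goal of the dead line `registered`: that line's open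
cores (S1r first-zero rate ⟺ reverse edge hyperscaling, EDGE) are two-sided Lee–Yang-edge statements in the
near-critical window with no handle but the summit; here the single open core is a ONE-POINT boundary-magnetisation
bound at `β_c`, `h = 0` (FKG-monotone in the volume, attackable by reflection / mirror coupling / random-current one-arm
technology — the ArmHyperscaling programme), and every Lee–Yang ingredient used is already a theorem.
Barriers honoured: `IsingTrivialityFromDimensionFour` / `LongRangeTrivialityOnZ3` — the open core is false for
`d ≥ 5` ((m⁺_n)² ~ n⁻² ≫ n^{2−d}), as any supplier of clause (iii) must be; `TransverseCrossingsNeedNotMeet` — no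
intersection-of-paths argument is used; `AxisProfileAxiomaticsNoDoubling` — `stub_simultaneousScales` does NOT claim
doubling at all scales (refuted axiomatically, item 6150 numerics aside) but only at a density-positive set of dyadic
scales, which the envelopes force. Disproof used: none on this crux (no `Disproof.lean` in `Cruxes/NearCriticalLeeYangGap`).
[cite: Newman1975, Thm 3] [cite: CamiaGarbanNewman2016, Thm 1.2] [cite: AizenmanDuminilCopinAnnals2021, Thm 5.12]
-/

noncomputable section

namespace Summit.CriticalPhenomena.Ising3DConformalLimit.Cruxes.NearCriticalLeeYangGap.OneArmSaturation

open Literature.Probability.LatticeModels Filter Set Finset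
open scoped Topology BigOperators
open Summit.CriticalPhenomena.Ising3DConformalLimit.Theses

/-! ## The statements -/

/-- The MATCHED UPPER CRITICAL ISOTHERM at block scale `L` with constant `C`:
`(2L+1)³ · m(β_c, C/√Σ_L) ≤ ½ β_c C √Σ_L`, `Σ_L = ⟨M_L²⟩⁺_{β_c}`. -/
def Matched (C : ℝ) (L : ℕ) : Prop :=
  (2 * (L : ℝ) + 1) ^ 3 * magnetizationInField 3 (criticalBeta 3)
      (C / Real.sqrt (plusExpect 3 (criticalBeta 3) 0 (fun σ => (∑ x ∈ box 3 L, spinAt x σ) ^ 2))) ≤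
    criticalBeta 3 * C / 2 *
      Real.sqrt (plusExpect 3 (criticalBeta 3) 0 (fun σ => (∑ x ∈ box 3 L, spinAt x σ) ^ 2))

/-- The matched upper critical isotherm FREQUENTLY in the block scale. -/
def MatchedIsothermFrequently : Prop :=
  ∃ C : ℝ, 0 < C ∧ ∃ᶠ L : ℕ in atTop, Matched C L

/-- **S2 (NEW): simultaneous good scales.** There is an absolute `η₀ ∈ (0,1]` such that for all
`0 < t ≤ η ≤ η₀` there is `R ≥ 0` with, for INFINITELY MANY `L`, simultaneously
(F) `Σ_{z∈Λ_{⌊ηL⌋}} G_c(z) ≤ (1/108)·Σ_{z∈Λ_{L/2}} G_c(z)` (field-term doubling) and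
(B) `G_c(2⌊tL⌋e₀) ≤ R·G_c(2Le₀)` (axis ratio across the fixed factor `1/t`). -/
def SimultaneousScales : Prop :=
  ∃ η₀ : ℝ, 0 < η₀ ∧ η₀ ≤ 1 ∧ ∀ η t : ℝ, 0 < t → t ≤ η → η ≤ η₀ →
    ∃ R : ℝ, 0 ≤ R ∧ ∃ᶠ L : ℕ in atTop,
      (∑ z ∈ box 3 ⌊η * L⌋₊, criticalTwoPoint 3 z ≤
          1 / 108 * ∑ z ∈ box 3 (L / 2), criticalTwoPoint 3 z) ∧
      criticalTwoPoint 3 (Pi.single 0 (2 * ((⌊t * L⌋₊ : ℕ) : ℤ))) ≤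
        R * criticalTwoPoint 3 (Pi.single 0 ((2 * L : ℕ) : ℤ))

/-! ## Registered stubs (the ONLY `sorry`s of the file) -/

/-- **S1 (OPEN, hardest; item stmt-CriticalPhenomena-15591 BY NAME).** One-arm hyperscaling on `ℤ³`:
`∃ K ≥ 1, C, ∀ n ≥ 1, (⟨σ₀⟩⁺_{Λ_{Kn},β_c})² ≤ C·⟨σ₀σ_{2ne₀}⟩_{β_c}` (Tasaki's inequality saturated).
Why plausibly true: hyperscaling in `d = 3` (ρ = Δ_σ numerically; MC j024350 of the 15591 refuter: the ratio
saturates). Size: open problem (XL). Leans on: route ArmHyperscaling (lines `mirror-face-saturation`, QT). -/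
theorem stub_oneArmHyperscaling : ArmHyperscaling.OneArmHyperscaling := by
  sorry

/-- **S2 (NEW, size M–L).** `SimultaneousScales`. Why true: suppose for some `0 < t ≤ η ≤ η₀` and EVERY `R`
eventually `¬(F) ∨ ¬(B)`. Work on dyadic `L = 2^i` with `P(N) := Σ_{k≤N} k²g(k)`, `g(k) = G_c(ke₀)`
(`χ'(N) := Σ_{Λ_N} G_c ≍ P(N)` by MMS `g(‖z‖₁) ≤ G_c(z) ≤ g(‖z‖_∞)`). (i) `¬(B)` at `2^i` forces a drop
`g(2^{i-p}) > R·g(2^{i+1})`, `p = ⌈log₂(1/t)⌉+1`; disjoint such windows multiply, and `g ≤ 1`, `g(n) ≥ c/n²`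
(`axis_sq_level_ge`) bound the number of `¬(B)`-scales in `[i₀,i₁]` by `(p+2)(i₁ log 4 − log c)/log R` — density
`→ 0` as `R → ∞`. (ii) `¬(F)` at `2^{i+1}` gives `P(2^i) ≤ K₁·P(2^{i+2−q})`, `2^{-q} ≤ η < 2^{1−q}`, `K₁` absolute
(MMS constants × 108); a `¬(B)`-scale costs at most the trivial `P(2N) ≤ 33·P(N)` (axis antitonicity). Chaining
down from `i₁`: `log P(2^{i₁}) ≤ ε_R i₁ log 33 + (i₁/(q−2)+1) log K₁ + O(1)`, contradicting `P(N) ≥ cN` once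
`log K₁/(q−2) < ½ log 2` (choice of `η₀`) and `ε_R log 33 < ½ log 2` (choice of `R`). Leans on: `axis_sq_level_ge`,
`axis_level_le`, axis antitonicity, MMS comparisons (all in tree). -/
theorem stub_simultaneousScales : SimultaneousScales := by
  sorry

/-- **S3 (size M).** One-arm hyperscaling and the simultaneous good scales give the matched upper critical
isotherm frequently: at an `L` where (F) and (B) hold, with `K, C₀` from S1, `t = η₀/K`, `N = K⌊tL⌋ ≤ ⌊η₀L⌋`:
Step 1 (`mag_le_boxMag_add`, GHS/GKS, landed) `m(β_c,h) ≤ a(N) + β_c χ(N) h`; Step 2 (field term, (F) +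
`card_mul_boxSum_le_blockSum`) `V_L χ(N) ≤ Σ_L/4`; Step 3 (boundary term, S1 + (B) + `card_sq_mul_axis_le_blockSum`)
`(V_L a(N))² ≤ 729 C₀ R · Σ_L`; Step 4 `matched_arith` with `C = 4(√A+1)/β_c`. This is the landed
`ArmHyperscalingMergingFloor.stub_oneArmGivesMatchedIsotherm` with `filter_upwards [hdbl, hratio, …]` replaced by
`Frequently.mono` on the conjunction supplied by S2. -/
theorem stub_matchedIsothermFrequently_of_oneArm :
    ArmHyperscaling.OneArmHyperscaling → SimultaneousScales → MatchedIsothermFrequently := by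
  sorry

/-! ## Proved: matched isotherm frequently ⟹ Binder floor frequently ⟹ the crux -/

/-- **Matched saturation forces a Binder floor, scale by scale** (the pointwise core of the landed
`ArmHyperscalingMergingFloor.eventually_binder_ge_of_matchedIsotherm`, run under `∃ᶠ`): Lee–Yang deficit
(`stub_leeYangDeficit`, landed) + GKS block-field domination (`stub_blockFieldDomination`, landed) +
`binder_lower_of_saturation`. [cite: Newman1975, Thm 3] -/
theorem frequently_binder_ge_of_matchedIsotherm {C : ℝ} (hC : 0 < C)
    (hfr : ∃ᶠ L : ℕ in atTop, Matched C L) :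
    ∃ᶠ L : ℕ in atTop,
      1 / (2 * criticalBeta 3 ^ 2 * C ^ 2) ≤
        (3 * (plusExpect 3 (criticalBeta 3) 0 (fun σ => (∑ x ∈ box 3 L, spinAt x σ) ^ 2)) ^ 2 -
              plusExpect 3 (criticalBeta 3) 0 (fun σ => (∑ x ∈ box 3 L, spinAt x σ) ^ 4)) /
            (plusExpect 3 (criticalBeta 3) 0 (fun σ => (∑ x ∈ box 3 L, spinAt x σ) ^ 2)) ^ 2 := by
  have hβ : 0 < criticalBeta 3 := criticalBeta_pos_holds (d := 3) (by norm_num)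
  refine hfr.mono fun L hL => ?_
  set Sg : ℝ := plusExpect 3 (criticalBeta 3) 0 (fun σ => (∑ x ∈ box 3 L, spinAt x σ) ^ 2) with hSgdef
  have hSg : 0 < Sg := by
    simpa [hSgdef, Literature.Barriers.CriticalPhenomena.blockVariance,
      Literature.Barriers.CriticalPhenomena.blockSpin] using
      Literature.Barriers.CriticalPhenomena.blockVariance_pos (d := 3) (criticalBeta_nonneg 3) L
  set h : ℝ := C / Real.sqrt Sg with hh
  have hh0 : 0 ≤ h := by positivity
  have hdom := PerfectScreeningCoulombImpliesNontrivial.stub_blockFieldDomination L h hh0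
  obtain ⟨hZ, hdefL⟩ := ArmHyperscalingMergingFloor.stub_leeYangDeficit L (criticalBeta 3 * h) (by positivity)
  have hL' : (2 * (L : ℝ) + 1) ^ 3 * magnetizationInField 3 (criticalBeta 3) h ≤
      criticalBeta 3 * C / 2 * Real.sqrt Sg := by
    simpa [Matched, hh, hSgdef] using hL
  have key := ArmHyperscalingMergingFloor.binder_lower_of_saturation (β := criticalBeta 3) (C := C) (Sg := Sg)
    (K := 3 * Sg ^ 2 - plusExpect 3 (criticalBeta 3) 0 (fun σ => (∑ x ∈ box 3 L, spinAt x σ) ^ 4))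
    hβ hC hSg hZ (by simpa [hh, mul_assoc] using hdefL) hdom (by simpa [hh] using hL')
  simpa [hSgdef] using key

/-- **The matched upper critical isotherm frequently implies the crux**: the Binder floor at infinitely many
scales forbids `g_L → 0`, and `¬(g_L → 0) ⟹ NearCriticalLeeYangGap` is the landed
`PerfectScreeningCoulombImpliesNontrivial.stub_gapOfBinderNonvanishing` (`θ₁²Σ_L ≤ 3π²/(2ε)`). -/
theorem gap_of_matchedIsothermFrequently :
    MatchedIsothermFrequently →
      Summit.CriticalPhenomena.Ising3DConformalLimit.Theses.LeeYangGap.NearCriticalLeeYangGap := by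
  rintro ⟨C, hC, hfr⟩
  refine PerfectScreeningCoulombImpliesNontrivial.stub_gapOfBinderNonvanishing ?_
  intro hT
  have hε : (0 : ℝ) < 1 / (2 * criticalBeta 3 ^ 2 * C ^ 2) := by
    have hβ : 0 < criticalBeta 3 := criticalBeta_pos_holds (d := 3) (by norm_num)
    positivity
  have hev := hT.eventually (gt_mem_nhds hε)
  obtain ⟨L, hge, hlt⟩ := ((frequently_binder_ge_of_matchedIsotherm hC hfr).and_eventually hev).exists
  exact absurd hlt (not_lt.2 hge)

/-! ## Name-keyed statements of the stubs (hypothesis types of the composition) -/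
namespace Registered

/-- Statement of S2 `stub_simultaneousScales`, keyed by the stub name. -/
abbrev stub_simultaneousScales : Prop := SimultaneousScales

/-- Statement of S3 `stub_matchedIsothermFrequently_of_oneArm`, keyed by the stub name. -/
abbrev stub_matchedIsothermFrequently_of_oneArm : Prop :=
  ArmHyperscaling.OneArmHyperscaling → SimultaneousScales → MatchedIsothermFrequently

end Registered

/-! ## Composition -/

/-- **COMPOSITION.** `OneArmHyperscaling` (item stmt-CriticalPhenomena-15591, BY NAME) → S2 → S3 →
`NearCriticalLeeYangGap` (item stmt-CriticalPhenomena-4945, BY NAME). No `sorry`. -/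
theorem NearCriticalLeeYangGap_of (h₁ : ArmHyperscaling.OneArmHyperscaling)
    (h₂ : Registered.stub_simultaneousScales)
    (h₃ : Registered.stub_matchedIsothermFrequently_of_oneArm) :
    Summit.CriticalPhenomena.Ising3DConformalLimit.Theses.LeeYangGap.NearCriticalLeeYangGap :=
  gap_of_matchedIsothermFrequently (h₃ h₁ h₂)

/-- The crux from the three registered stubs (type-checks that the stubs have exactly the hypothesis types). -/
theorem NearCriticalLeeYangGap_of_stubs :
    Summit.CriticalPhenomena.Ising3DConformalLimit.Theses.LeeYangGap.NearCriticalLeeYangGap :=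
  NearCriticalLeeYangGap_of stub_oneArmHyperscaling stub_simultaneousScales
    stub_matchedIsothermFrequently_of_oneArm

/-- **PAYER EDGE (modulo the two provable stubs S2, S3):** item 15591 ⟹ item 4945. Once S2 and S3 land this is an
unconditional tree theorem `OneArmHyperscaling → NearCriticalLeeYangGap`. -/
theorem nearCriticalLeeYangGap_of_oneArmHyperscaling
    (h₂ : Registered.stub_simultaneousScales) (h₃ : Registered.stub_matchedIsothermFrequently_of_oneArm) :
    ArmHyperscaling.OneArmHyperscaling →
      Summit.CriticalPhenomena.Ising3DConformalLimit.Theses.LeeYangGap.NearCriticalLeeYangGap :=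
  fun h₁ => NearCriticalLeeYangGap_of h₁ h₂ h₃

end Summit.CriticalPhenomena.Ising3DConformalLimit.Cruxes.NearCriticalLeeYangGap.OneArmSaturation
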